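import Literature.AlgebraicGeometry.GroupSchemes.CartierDualMap
import Literature.AlgebraicGeometry.GroupSchemes.GroupSchemeKernel
import HarnessLib

/-!
# The annihilator `H^⊥ ⊂ G^D` of a subgroup `H → G`: the kernel of `G^D → H^D` (Tate 1997 §(3.8); Görtz–Wedhorn I Def. 4.45)

Layer `Literature/AlgebraicGeometry/GroupSchemes`, namespace `Literature.AlgebraicGeometry.GroupSchemes.AffineGroupScheme` (continues ★
`CartierDualFiniteFlat` p845244 ∕ ED. 2 p845403 — `cartierDual G = G^D` with its instances —, ★ `CartierDualMap` p845343 — `cartierDualMap j = j^D`,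
`DualAlg.transpose`, `coord_comp_cartierDualMap` — and ★ `GroupSchemeKernel` — `ker`, `kerι`, `grpObjKer`, `kerPoints`,
`isClosedImmersion_kerι_left_of_isSeparated`).  DEFINITIONS (`annihilator j`, `annihilatorι j`) + one instance on the file's own morphism
`cartierDualMap j` (`IsMonHom`, = ★ `isMonHom_cartierDualMap`, needed by `GroupSchemeKernel.ker`) + theorems; no notation, no named fact, no `sorry`.
Cell `hodgecm-mathlib` (D-0151), programme P6 «MOD», HEART organ (g1) rider (a) (LEAD F0P6-plan (g0) 16:15:19Z «= rider (a) FIRST»; consumer A-p17 (g24)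
ST-0′ ∕ (H4) comparison «`ker ψ^∨ ↪ (ker ψ)^D`»; B-p04 (g37)).  Count-neutral Mathlib-side capital: HC_CM is proved only modulo the 7 printed citations
until rung 0 closes; nothing here bears on it.

THE PRINT ([Tate1997FiniteFlatGroupSchemes] §(3.8) p. 146: Cartier duality is exact, so for a closed subgroup `H ⊂ G` the characters of `G` trivial on `H`
form `(G⧸H)^D = ker (G^D → H^D)`; [GortzWedhorn2020] Def. 4.45 (2): kernels of homomorphisms).  The tree has NO quotient `G⧸H` by a non-constant
finite flat subgroup scheme (F0P6-p13 (g0) census 15:24:10Z); THIS FILE builds the annihilator DIRECTLY as a kernel, for any homomorphism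
`j : H ⟶ G` of finite free commutative group schemes over `R`:

* §1 `cartierDualMap.instIsMonHom`, **`annihilator j := GroupSchemeKernel.ker (cartierDualMap j)`** (`H^⊥ ⊂ G^D`; a group object by ★ `grpObjKer`),
  **`annihilatorι j : annihilator j ⟶ cartierDual G`** (a homomorphism, a monomorphism, and a CLOSED IMMERSION — `G^D → Spec R` is affine hence
  separated), `annihilatorι_comp : ι ≫ j^D = 1`.
* §2 POINTS: **`annihilatorPoints j T : (T ⟶ annihilator j) ≃* ker (G^D(T) → H^D(T))`** (★ `kerPoints`), `comp_cartierDualMap_eq_one_iff`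
  (`x ≫ j^D = 1 ↔ coord x ∘ transpose j = η ∘ ε` — «the character `x` of `G` is TRIVIAL ON `H`»), `exists_eq_comp_annihilatorι_iff`
  (a `T`-point of `G^D` factors through `H^⊥` iff its character is trivial on `H`), `annihilatorLift`.

NOT here: the rank clause `rk H^⊥ · rk H = rk G` for a closed immersion `j` over a field (it is «a finite commutative Hopf algebra over a field is
free over a Hopf subalgebra» applied to `Γ(H)^* ⊂ Γ(G)^*` — [Waterhouse1979 §14], not in the tree; reported to LEAD as the one missing input),
base change of `H^⊥`.

## References
* [Tate1997FiniteFlatGroupSchemes] J. Tate, *Finite flat group schemes*, in: Modular Forms and Fermat's Last Theorem (1997), §(3.8) pp. 144–146.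
* [GortzWedhorn2020] U. Görtz, T. Wedhorn, *Algebraic Geometry I: Schemes*, 2nd ed. (2020), (4.15) Definition 4.45, p. 117.
-/

set_option autoImplicit false

-- Mathlib's `Over`/`Scheme` APIs are stated across semireducible wrappers (as in the ★ `GroupSchemes/*` files).
set_option backward.isDefEq.respectTransparency false

universe u

open CategoryTheory CategoryTheory.Limits AlgebraicGeometry MonoidalCategory CartesianMonoidalCategory TensorProduct WithConv

noncomputable section

namespace Literature.AlgebraicGeometry.GroupSchemes

namespace AffineGroupScheme

open scoped MonObj

open Literature.AlgebraicGeometry.Motives Literature.NumberTheory.DiophantineGeometry Literature.RingTheory.HopfAlgebra GroupSchemeKernel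

variable {R : Type u} [CommRing R] {H G : SchemeOver R}
  [GrpObj H] [IsCommMonObj H] [IsAffine H.left] [Module.Free R (Alg H)] [Module.Finite R (Alg H)]
  [GrpObj G] [IsCommMonObj G] [IsAffine G.left] (j : H ⟶ G) [IsMonHom j]

/-! ## §1 `H^⊥ := ker (j^D : G^D → H^D)` -/

/-- `j^D : G^D → H^D` is a homomorphism — instance form of ★ `isMonHom_cartierDualMap` for the instances ★ `cartierDual.instGrpObj`
(needed by ★ `GroupSchemeKernel.ker`). [cite: Tate1997FiniteFlatGroupSchemes, §(3.8) p. 145] -/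
instance cartierDualMap.instIsMonHom [Module.Free R (Alg G)] [Module.Finite R (Alg G)] : IsMonHom (cartierDualMap j) :=
  isMonHom_cartierDualMap j

/-- **The annihilator `H^⊥ ⊂ G^D` of `j : H → G`**: the kernel of the Cartier dual `j^D : G^D → H^D` (★ `GroupSchemeKernel.ker` =
`G^D ×_{H^D, e} Spec R`); for a closed subgroup `H` it plays the role of `(G⧸H)^D` ([Tate1997FiniteFlatGroupSchemes] §(3.8): duality is exact).
It is a group object by ★ `GroupSchemeKernel.grpObjKer`. [cite: Tate1997FiniteFlatGroupSchemes, §(3.8) p. 146] -/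
def annihilator : SchemeOver R := ker (cartierDualMap j)

/-- `H^⊥` IS `ker (j^D)`. [cite: Tate1997FiniteFlatGroupSchemes, §(3.8) p. 146] -/
theorem annihilator_def : annihilator j = ker (cartierDualMap j) := rfl

/-- The group structure of `H^⊥` (★ `grpObjKer`, registered on this file's name for the object). [cite: GortzWedhorn2020, Definition 4.45 (2), p. 117] -/
instance annihilator.instGrpObj [Module.Free R (Alg G)] [Module.Finite R (Alg G)] : GrpObj (annihilator j) :=
  grpObjKer (cartierDualMap j)

/-- **The inclusion `H^⊥ → G^D`** (★ `kerι`). [cite: GortzWedhorn2020, Definition 4.45 (2), p. 117] -/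
def annihilatorι : annihilator j ⟶ cartierDual G := kerι (cartierDualMap j)

/-- `annihilatorι` IS `kerι (j^D)`. [cite: GortzWedhorn2020, Definition 4.45 (2), p. 117] -/
theorem annihilatorι_def : annihilatorι j = kerι (cartierDualMap j) := rfl

/-- `H^⊥ → G^D → H^D` is trivial. [cite: GortzWedhorn2020, Definition 4.45 (2), p. 117] -/
theorem annihilatorι_comp : annihilatorι j ≫ cartierDualMap j = 1 := kerι_comp (cartierDualMap j)

/-- `H^⊥ → G^D` is a homomorphism (★ `isMonHom_kerι`). [cite: GortzWedhorn2020, Definition 4.45 (2), p. 117] -/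
instance annihilatorι.instIsMonHom [Module.Free R (Alg G)] [Module.Finite R (Alg G)] : IsMonHom (annihilatorι j) :=
  isMonHom_kerι (cartierDualMap j)

/-- `H^⊥ → G^D` is a monomorphism (★ `mono_kerι`). [cite: GortzWedhorn2020, Definition 4.45 (2), p. 117] -/
theorem mono_annihilatorι : Mono (annihilatorι j) := mono_kerι (cartierDualMap j)

/-- **`H^⊥ → G^D` is a CLOSED IMMERSION** — `H^⊥` is a closed subgroup scheme of `G^D`: `H^D → Spec R` is affine, hence separated, so its unit
section is a closed immersion and ★ `isClosedImmersion_kerι_left_of_isSeparated` applies. [cite: GortzWedhorn2020, Definition 4.45 (2), p. 117] -/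
theorem isClosedImmersion_annihilatorι_left : IsClosedImmersion (annihilatorι j).left :=
  isClosedImmersion_kerι_left_of_isSeparated (cartierDualMap j)

/-- `H^⊥` is affine (a closed subscheme of the affine `G^D`). [cite: GortzWedhorn2020, Definition 4.45 (2), p. 117] -/
theorem isAffine_annihilator_left : IsAffine (annihilator j).left :=
  haveI := isClosedImmersion_annihilatorι_left j
  isAffine_of_isAffineHom (annihilatorι j).left

/-! ## §2 Points of `H^⊥`: the characters of `G` that are trivial on `H` -/

section Points

variable (T : SchemeOver R)

/-- **`H^⊥(T) ≃* ker (G^D(T) → H^D(T))`** (★ `kerPoints`): the `T`-points of the annihilator are the `T`-points `x` of `G^D` with `x ≫ j^D = 1`.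
[cite: GortzWedhorn2020, Definition 4.45 (2), p. 117] -/
def annihilatorPoints [Module.Free R (Alg G)] [Module.Finite R (Alg G)] :
    (T ⟶ annihilator j) ≃* (IsMonHom.monoidHom (cartierDualMap j) T).ker :=
  kerPoints (cartierDualMap j) T

variable {T}

/-- Unfolding: the underlying point of `G^D` is `k ≫ ι`. [cite: GortzWedhorn2020, Definition 4.45 (2), p. 117] -/
theorem annihilatorPoints_apply_coe [Module.Free R (Alg G)] [Module.Finite R (Alg G)] (k : T ⟶ annihilator j) :
    (annihilatorPoints j T k).1 = k ≫ annihilatorι j := rfl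

/-- **`x ≫ j^D = 1` iff the character is trivial on `H`**: in coordinates (★ `coord`, ★ `coord_comp_cartierDualMap`), a `T`-point `x` of `G^D`
— an algebra map `coord x : Γ(G)^* → Γ(T)` — dies in `H^D` iff `coord x ∘ transpose j` is the convolution UNIT `η_{Γ(T)} ∘ ε_{Γ(H)^*}` of
`Hom(Γ(H)^*, Γ(T))`, i.e. the restriction of the character to `H` is trivial. [cite: Tate1997FiniteFlatGroupSchemes, §(3.8) p. 146] -/
theorem comp_cartierDualMap_eq_one_iff (x : T ⟶ cartierDual G) :
    x ≫ cartierDualMap j = 1 ↔ (coord x).comp (DualAlg.transpose j) = (1 : WithConv (DualAlg H →ₐ[R] Alg T)).ofConv := by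
  rw [← coord_comp_cartierDualMap, ← coord_one_eq (R := R) (H := DualAlg H) (T := T)]
  exact ⟨fun h => by rw [h], fun h => coord_injective h⟩

/-- **A `T`-point of `G^D` factors through `H^⊥` iff its character is trivial on `H`.** [cite: Tate1997FiniteFlatGroupSchemes, §(3.8) p. 146] -/
theorem exists_eq_comp_annihilatorι_iff (x : T ⟶ cartierDual G) :
    (∃ k : T ⟶ annihilator j, k ≫ annihilatorι j = x) ↔
      (coord x).comp (DualAlg.transpose j) = (1 : WithConv (DualAlg H →ₐ[R] Alg T)).ofConv := by
  rw [← comp_cartierDualMap_eq_one_iff]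
  constructor
  · rintro ⟨k, rfl⟩
    rw [Category.assoc, annihilatorι_comp, MonObj.comp_one]
  · intro h
    exact ⟨kerLift x h, kerLift_ι x h⟩

/-- **The lift to `H^⊥`** of a point of `G^D` whose character is trivial on `H` (★ `kerLift`). [cite: GortzWedhorn2020, Definition 4.45 (2), p. 117] -/
def annihilatorLift (x : T ⟶ cartierDual G) (hx : (coord x).comp (DualAlg.transpose j) = (1 : WithConv (DualAlg H →ₐ[R] Alg T)).ofConv) :
    T ⟶ annihilator j :=
  kerLift x ((comp_cartierDualMap_eq_one_iff j x).2 hx)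

/-- `annihilatorLift x hx ≫ ι = x`. [cite: GortzWedhorn2020, Definition 4.45 (2), p. 117] -/
theorem annihilatorLift_comp_ι (x : T ⟶ cartierDual G)
    (hx : (coord x).comp (DualAlg.transpose j) = (1 : WithConv (DualAlg H →ₐ[R] Alg T)).ofConv) :
    annihilatorLift j x hx ≫ annihilatorι j = x :=
  kerLift_ι x _

/-- Two points of `H^⊥` agree iff they agree in `G^D` (★ `ker_hom_ext`). [cite: GortzWedhorn2020, Definition 4.45 (2), p. 117] -/
theorem annihilator_hom_ext {a b : T ⟶ annihilator j} (h : a ≫ annihilatorι j = b ≫ annihilatorι j) : a = b := ker_hom_ext h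

end Points

end AffineGroupScheme

end Literature.AlgebraicGeometry.GroupSchemes

end
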